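import Literature.MathematicalPhysics.QuantumLattice.TorusSectorGibbsMixture
import Literature.MathematicalPhysics.QuantumLattice.DWaveSourceNNNHopping
import HarnessLib

/-!
# The grand-canonical Gibbs state of the pair-sourced `t–t'` Hubbard torus as an eigen-mixture (definitions)

Family `hubbard` (topic `MathematicalPhysics/QuantumLattice`); stage S2 of the Hubbard material oracle («certifier families …
`T > 0`», D-0096 (iii)): the `T`-axis of the pairing-response annex. This file only NAMES the thermal object; the theorems
(unit eigenvectors, weights, the finite-volume energy–entropy cap and the thermodynamic-limit window
`e_src ≤ e_Ψ(ω) ≤ e_src + (log 4)/β`) are in `DWaveSourceThermalGibbsTorusLimit.lean`, the `T > 0` response floor in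
`DWaveSourceThermalResponseFloor.lean`.

The pair source `−h(Δ_d + Δ_d†)` of `A_L(t',U,μ,h) = dWaveSourceTorusTT' L t' U μ h` does not conserve the particle number, so
the thermal object is GRAND-CANONICAL: the Gibbs state `ρ_{L,β} = e^{−βA_L}/tr e^{−βA_L}` on the whole Fock space of the
`L × L` torus, written — as in `TorusSectorGibbsMixture` §1–§2 with the TRIVIAL coordinate sector — as the finite mixture of an
orthonormal eigenbasis of `A_L` (`sectorEigenvector (fun _ => True)`) with the Boltzmann weights (`canonicalWeight`) of its
eigenvalues (`sectorEigenvalue (fun _ => True)`), in the format `(m, p, ψ)` of `InfVolFermionState.IsTorusLimitOfMixture`: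
`sourcedGibbsCount L` (`= 4^{L²}`), `sourcedGibbsIndex L`, `sourcedGibbsEnergyTT' t' U μ h L i`,
`sourcedGibbsVectorTT' t' U μ h L i`, `sourcedGibbsWeightTT' β t' U μ h L i` (junk `0` at side `L = 0`, where `A_L` is not
defined). No theorem, no instance, no notation.

## References

* R. B. Israel, *Convexity in the Theory of Lattice Gases* (1979), Lemma II.3.1 and §I.3 eq. (26) (finite-volume Gibbs
  states and their variational principle). [cite: Israel1979, Lemma II.3.1]
* T. Koma, H. Tasaki, J. Stat. Phys. 76 (1994) 745, §1 (the sourced model). [cite: KomaTasaki1994, §1]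
-/

noncomputable section

namespace Literature.MathematicalPhysics.QuantumLattice

open Matrix Finset HubbardWave0 Literature.Probability.LatticeModels

/-- The number of components of the grand-canonical Gibbs mixture: the number of Fock configurations of
the `L × L` torus (all coordinate vectors; the trivial sector of `TorusSectorGibbsMixture` §1).
[cite: Israel1979, Lemma II.3.1] -/
def sourcedGibbsCount (L : ℕ) : ℕ :=
  Fintype.card (Subtype (fun _ : Finset (Orb (FermionTorus 2 L)) => True))

/-- Enumeration of the Fock configurations by `Fin (sourcedGibbsCount L)` (plumbing for the mixture format).
[cite: Israel1979, Lemma II.3.1] -/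
def sourcedGibbsIndex (L : ℕ) :
    Fin (sourcedGibbsCount L) ≃ Subtype (fun _ : Finset (Orb (FermionTorus 2 L)) => True) :=
  (Fintype.equivFin _).symm

/-- The energies of the grand-canonical Gibbs mixture: the eigenvalues of
`A_L = dWaveSourceTorusTT' L t' U μ h` (junk `0` at side `L = 0`). [cite: Israel1979, Lemma II.3.1] -/
def sourcedGibbsEnergyTT' (tp U μ h : ℝ) (L : ℕ) (i : Fin (sourcedGibbsCount L)) : ℝ :=
  if hL : L = 0 then 0 else
    haveI : NeZero L := ⟨hL⟩
    sectorEigenvalue (fun _ => True) (dWaveSourceTorusTT' L tp U μ h)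
      (dWaveSourceTorusTT'_isHermitian L tp U μ h) (sourcedGibbsIndex L i)

/-- The components of the grand-canonical Gibbs mixture: an orthonormal eigenbasis of
`A_L = dWaveSourceTorusTT' L t' U μ h` (junk `0` at side `L = 0`). [cite: Israel1979, Lemma II.3.1] -/
def sourcedGibbsVectorTT' (tp U μ h : ℝ) (L : ℕ) (i : Fin (sourcedGibbsCount L)) :
    Fock (Orb (FermionTorus 2 L)) :=
  if hL : L = 0 then 0 else
    haveI : NeZero L := ⟨hL⟩
    sectorEigenvector (fun _ => True) (dWaveSourceTorusTT' L tp U μ h)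
      (dWaveSourceTorusTT'_isHermitian L tp U μ h) (sourcedGibbsIndex L i)

/-- The weights of the **grand-canonical Gibbs state** `ρ_{L,β} = e^{−βA_L}/tr e^{−βA_L}` of the pair-sourced
torus written as a mixture of its eigenbasis: `p_{L,i} = e^{−βE_{L,i}}/Σ_j e^{−βE_{L,j}}`.
[cite: Israel1979, §I.3 eq. (26)] -/
def sourcedGibbsWeightTT' (β tp U μ h : ℝ) (L : ℕ) (i : Fin (sourcedGibbsCount L)) : ℝ :=
  canonicalWeight β (sourcedGibbsEnergyTT' tp U μ h L) i

end Literature.MathematicalPhysics.QuantumLattice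

end
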